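import Summits.QuantumFields.BalabanUV.Beta.FP.ScalarPropagatorProjection
import Literature.MathematicalPhysics.QuantumFieldTheory.Balaban1983to89.B5GreenBridgeP12Green
import Literature.MathematicalPhysics.QuantumFieldTheory.Balaban1983to89.B5QGGQ145Bounds
import Literature.MathematicalPhysics.QuantumFieldTheory.Balaban1983to89.B5Hk163TorusHolderRate

/-!
# `BalabanUV.Beta.FP.CoarseSandwichInverseRowSum` — road «FP» (binder row D1), lane IR-5′, **THE (T0′) SUPPLIER CHAIN, FILE 5: THE COARSE
# SANDWICH LETTER `cC = ‖(Q′G′²Q′*)⁻¹‖_{∞→∞}` IS IN THE TREE** — b05's `(Q′·G′·G′·Q′*)⁻¹` (`G′ = (Δ + bQ′*Q′)⁻¹`) IS pv17∕pv15's (1.45) inverse kernel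
# `kerRe = torusKernel145M` through b04's `K_T = G′Q′*` (`B5GreenBridgeP12Green.green_KTvec`), and its row sums are bounded UNIFORMLY in `n` and in
# the torus by `B5Torus145Decay.inverse145_torusKernelM_decay_torusMetric` + the uniform torus sum (our bookkeeping; index bridges only)

HONEST DEPENDENCY (page 1, mandatory): continuum YM on T⁴ ⇐ BetaPertH ∧ nine spine estimates (0/9 proved); BetaPertH ⇐ (D1) ∧ (D4) ∧
CAP+tail; G-an2-4 gates asym, D1 and NE2/3/4.  HONEST FRAMING (cell contract, verbatim): «discharging `BetaPertH` makes Bałaban's UV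
stability UNCONDITIONAL — a real constructive-QFT result; it is NOT the continuum limit and NOT the Clay problem.»  THIS MODULE is index bookkeeping
over tree theorems BY NAME: b04∕r02's Green identity `green_KTvec` (`(Δ + aQ′*Q′)·K_Tω = Q′*ω` on b05's torus), pv15's `B5QGGQ145Torus.qggq` ∕
`B5QGGQ145Bounds.qggqRe`∕`kerRe`∕`kerRe_mul_qggqRe` (the (1.45) Gram operator and its inverse as real matrices on `Π_μ Fin M_μ`), pv17's
`B5Torus145Decay.inverse145_torusKernelM_decay_torusMetric` (volume-uniform exponential decay of the inverse kernel, B5 p. 26 «γ₀ ≤ Q′_kG′_k²Q′_k* ≤ γ₁»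
+ the analyticity method), `B5Hk163TorusHolderRate.sum_exp_torusSupNorm_sub_rep_le` (uniform torus sum), and file 4a (`isUnit_DeltaP`, `QGGQ_eq_smul_gram`).
It cites nothing as a hypothesis, mints no `Prop`, has no `def`, 0 sorry; no estimate of ours.  NOT (T0′) (the three scalar `G′` letters `cG′ cD cD′` of
file 4b stay displayed), NOT hslice, NOT (ASYMP), NOT D1, NOT BetaPertH, NOT continuum, NOT Clay.

ABSOLUTE RULE (cell charter, verbatim): «No internally-minted statement may enter as a cited fact. Every hypothesis is either kernel-proved in this
package or a verbatim quotation of a PUBLISHED theorem with page reference. The manuscript(s) under audit are NOT citable for their own disputed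
steps — they are the thing under adjudication; programme-internal (2001/route/tribunal) claims are never citable.»

CONTENT (`M : Fin (d+1) → ℕ`, `n ≥ 1`, `b > 0`; `G′ := (Δ + bQ′*Q′)⁻¹` written out).  §1 `mem_box_rep`, `castU_rep`, `eq_rep_of_castU_eq`,
**`Gp_QsAdj_mulVec_eq_KTvec`** (`(G′·Q′*)ω = K_Tω`), **`Gp_QsAdj_apply`** (`(G′·Q′*)(x, y) = K_T(rep x, rep y)`); §2 `sum_repZ_eq_sum_box`,
**`QGGQ_apply_eq_qggq`** (`(Q′G′²Q′*)(y, y′) = qggq n b 0 M (rep y) (rep y′)`), **`QGGQ_eq_submatrix_qggqRe`**, **`QGGQ_inv_eq_submatrix_kerRe`**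
(`(Q′G′²Q′*)⁻¹ = kerRe` re-indexed by `torFin`); §3 **`norm_QGGQ_inv_apply`** (`‖(Q′G′²Q′*)⁻¹(y,y′)‖ = ‖torusKernel145M n b M (rep y − rep y′)‖`),
**`exists_rowSum_QGGQ_inv_le`**: for `0 < b₋ ≤ b₊` there are `κ c > 0` (functions of `d, b₋, b₊`) with
`Σ_{y′} ‖(Q′G′²Q′*)⁻¹(y,y′)‖ ≤ c⁻¹·periodConst κ d·latticeConst(d+1, κ∕(d+1))` for every `n ≥ 1`, every torus, every `b ∈ [b₋,b₊]`, every row — the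
letter `hC` of `CovarianceScalarLetters.rowSum_Cov_one_le_of_Gp_letters` DISCHARGED.
Unit `b2b-balaban-beta-d1-formalise-leaf-05` (gen 19), 2026-08-21; `LEAVES-FP.md` row «(T0′) CHAIN FILE 5».  «not in print; our bookkeeping».
-/

noncomputable section

open scoped BigOperators Matrix ComplexConjugate

namespace Summit.QuantumFields.BalabanUV.Beta.FP.CoarseSandwichInverseRowSum

open Literature.MathematicalPhysics.QuantumFieldTheory.Balaban1983to89
open Literature.MathematicalPhysics.QuantumFieldTheory.Balaban1983to89.B5Prop11Plancherel (Tor fine)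
open Literature.MathematicalPhysics.QuantumFieldTheory.Balaban1983to89.B5Action121 (LapS)
open Literature.MathematicalPhysics.QuantumFieldTheory.Balaban1983to89.B5Block118 (QsOp)
open Literature.MathematicalPhysics.QuantumFieldTheory.Balaban1983to89.B5Hk160Torus (QsAdj)
open Literature.MathematicalPhysics.QuantumFieldTheory.Balaban1983to89.B4TorusPositivity (box mem_box)
open Literature.MathematicalPhysics.QuantumFieldTheory.Balaban1983to89.B4TorusGreen244 (KT)
open Literature.MathematicalPhysics.QuantumFieldTheory.Balaban1983to89.B4TorusKernel (periodConst)
open Literature.MathematicalPhysics.QuantumFieldTheory.Balaban1983to89.B4TorusKernel.MultiPeriod (torusSupNorm)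
open Literature.MathematicalPhysics.QuantumFieldTheory.Balaban1983to89.B4Sect5Proof (latticeConst)
open Literature.MathematicalPhysics.QuantumFieldTheory.Balaban1983to89.B6LowerBound2153Torus (toT rep toT_rep rep_toT rep_mem_pbox)
open Literature.MathematicalPhysics.QuantumFieldTheory.Balaban1983to89.B6Lemma24Torus (mem_pbox)
open Literature.MathematicalPhysics.QuantumFieldTheory.Balaban1983to89.B5Kernel166Decay (torFin)
open Literature.MathematicalPhysics.QuantumFieldTheory.Balaban1983to89.B5Hk163TorusHolderRate (toZ_torFin sum_exp_torusSupNorm_sub_rep_le)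
open Literature.MathematicalPhysics.QuantumFieldTheory.Balaban1983to89.B5GreenBridgeP12Green (repZ castU KTvec green_KTvec)
open Literature.MathematicalPhysics.QuantumFieldTheory.Balaban1983to89.B5QGGQ145Torus (qggq)
open Literature.MathematicalPhysics.QuantumFieldTheory.Balaban1983to89.B5QGGQ145Bounds (Idx toZ sum_box_eq_sum_idx qggqRe kerRe qggqRe_coe kerRe_coe
  kerRe_mul_qggqRe)
open Literature.MathematicalPhysics.QuantumFieldTheory.Balaban1983to89.B5Torus145Decay (torusKernel145M inverse145_torusKernelM_decay_torusMetric)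
open Summit.QuantumFields.BalabanUV.Beta.FP.ScalarPropagatorProjection (inv_mul_DeltaP DeltaP_inv_conjTranspose QGGQ_eq_smul_gram)

variable {d : ℕ} (n : ℕ) [NeZero n] (hn : 1 ≤ n) (M : Fin (d + 1) → ℕ) [hM : ∀ μ, NeZero (M μ)] {b : ℝ} (hb : 0 < b)

/-! ## §1 `G′·Q′*` IS b04's `K_T` -/

omit hM in
/-- [folklore] the box representative of a unit-torus point lies in the period box. -/
theorem mem_box_rep [hM : ∀ μ, NeZero (M μ)] (y : Tor M) : rep M y ∈ box M :=
  mem_box.mpr fun i => ⟨Int.natCast_nonneg _, by simp only [rep]; exact_mod_cast ZMod.val_lt (y i)⟩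

omit hM in
/-- [folklore] `castU (rep y) = y` (`castU` = `toT`). -/
theorem castU_rep [hM : ∀ μ, NeZero (M μ)] (y : Tor M) : castU M (rep M y) = y := toT_rep M y

omit hM in
/-- [folklore] the box representative is the ONLY box point over its class. -/
theorem eq_rep_of_castU_eq [hM : ∀ μ, NeZero (M μ)] {y' : Fin (d + 1) → ℤ} (hy' : y' ∈ box M) {y : Tor M} (h : castU M y' = y) :
    y' = rep M y := by
  have hp : y' ∈ B6Lemma24Torus.pbox M := mem_pbox.mpr (mem_box.mp hy')
  rw [← h]
  exact (rep_toT M hp).symm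

include hn hb in
/-- [our bookkeeping] **`(G′·Q′*)ω = K_Tω`**: b04's Green identity `green_KTvec` (`(Δ + bQ′*Q′)·K_Tω = Q′*ω`) read through file 4a's
invertibility of `Δ + bQ′*Q′`. -/
theorem Gp_QsAdj_mulVec_eq_KTvec (ω : Tor M → ℂ) :
    ((LapS (fine n M) (n : ℂ) + (b : ℂ) • (QsAdj n M * QsOp n M))⁻¹ * QsAdj n M) *ᵥ ω = KTvec n M b ω := by
  have h := congrArg ((LapS (fine n M) (n : ℂ) + (b : ℂ) • (QsAdj n M * QsOp n M))⁻¹).mulVec (green_KTvec n M hn hb ω)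
  simp only [Matrix.mulVec_mulVec, inv_mul_DeltaP n M hb, Matrix.one_mulVec] at h
  exact h.symm

include hn hb in
/-- [our bookkeeping] **THE ENTRIES OF `G′·Q′*`**: `(G′·Q′*)(x, y) = K_T(rep x, rep y)` (`K_Tδ_y` has exactly one box term). -/
theorem Gp_QsAdj_apply (x : Tor (fine n M)) (y : Tor M) :
    ((LapS (fine n M) (n : ℂ) + (b : ℂ) • (QsAdj n M * QsOp n M))⁻¹ * QsAdj n M) x y = KT n b 0 M (repZ n M x) (rep M y) := by
  have h := congrFun (Gp_QsAdj_mulVec_eq_KTvec n hn M hb (Pi.single y 1)) x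
  rw [Matrix.mulVec_single_one, Matrix.col_apply] at h
  rw [h, KTvec]
  change ∑ y' ∈ box M, (Pi.single y (1 : ℂ) : Tor M → ℂ) (castU M y') * KT n b 0 M (repZ n M x) y' = _
  rw [Finset.sum_eq_single_of_mem (rep M y) (mem_box_rep M y)]
  · rw [castU_rep, Pi.single_eq_same, one_mul]
  · intro y' hy' hne
    rw [Pi.single_eq_of_ne (fun h' => hne (eq_rep_of_castU_eq M hy' h')), zero_mul]

/-! ## §2 `Q′G′²Q′*` IS pv15's (1.45) Gram matrix `qggqRe`, and its inverse IS `kerRe` -/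

omit hM in
/-- [folklore] fine-torus sums are box sums over the integer representatives (`torFin`, `sum_box_eq_sum_idx`). -/
theorem sum_repZ_eq_sum_box [hM : ∀ μ, NeZero (M μ)] (F : (Fin (d + 1) → ℤ) → ℂ) :
    ∑ x : Tor (fine n M), F (repZ n M x) = ∑ z ∈ box (fine n M), F z := by
  rw [sum_box_eq_sum_idx, ← (torFin (fine n M)).sum_comp]
  rfl

include hn hb in
/-- [our bookkeeping] **THE ENTRIES OF THE COARSE SANDWICH**: `(Q′·G′·G′·Q′*)(y, y′) = qggq n b 0 M (rep y) (rep y′)` —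
`Q′G′²Q′* = n^{−(d+1)}·(G′Q′*)ᴴ(G′Q′*)` (file 4a) with §1's entries, = pv15's `n^{−(d+1)} Σ_z conj K_T(z, y)·K_T(z, y′)`. -/
theorem QGGQ_apply_eq_qggq (y y' : Tor M) :
    (QsOp n M * (LapS (fine n M) (n : ℂ) + (b : ℂ) • (QsAdj n M * QsOp n M))⁻¹
        * (LapS (fine n M) (n : ℂ) + (b : ℂ) • (QsAdj n M * QsOp n M))⁻¹ * QsAdj n M) y y'
      = qggq n b 0 M (rep M y) (rep M y') := by
  rw [QGGQ_eq_smul_gram n M (DeltaP_inv_conjTranspose n M), Matrix.smul_apply, Matrix.mul_apply, smul_eq_mul, qggq]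
  congr 1
  rw [← sum_repZ_eq_sum_box n M (fun z => conj (KT n b 0 M z (rep M y)) * KT n b 0 M z (rep M y'))]
  refine Finset.sum_congr rfl fun x _ => ?_
  rw [Matrix.conjTranspose_apply, Gp_QsAdj_apply n hn M hb, Gp_QsAdj_apply n hn M hb, Complex.star_def]

include hn hb in
/-- [our bookkeeping] **`Q′G′²Q′* = qggqRe` re-indexed**: the b05 matrix is pv15's real Gram matrix on `Π_μ Fin M_μ` transported along `torFin`. -/
theorem QGGQ_eq_submatrix_qggqRe :
    QsOp n M * (LapS (fine n M) (n : ℂ) + (b : ℂ) • (QsAdj n M * QsOp n M))⁻¹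
        * (LapS (fine n M) (n : ℂ) + (b : ℂ) • (QsAdj n M * QsOp n M))⁻¹ * QsAdj n M
      = ((qggqRe n b M).map Complex.ofRealHom).submatrix (torFin M) (torFin M) := by
  have hM1 : ∀ i, 1 ≤ M i := fun i => Nat.one_le_iff_ne_zero.mpr (NeZero.ne (M i))
  ext y y'
  rw [Matrix.submatrix_apply, Matrix.map_apply, Complex.ofRealHom_eq_coe, qggqRe_coe n hn b hb hM1, toZ_torFin, toZ_torFin,
    QGGQ_apply_eq_qggq n hn M hb]

include hn hb in
/-- [our bookkeeping] **`(Q′G′²Q′*)⁻¹ = kerRe` re-indexed** (`kerRe·qggqRe = 1`, `B5QGGQ145Bounds.kerRe_mul_qggqRe`; uniqueness of the inverse). -/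
theorem QGGQ_inv_eq_submatrix_kerRe :
    (QsOp n M * (LapS (fine n M) (n : ℂ) + (b : ℂ) • (QsAdj n M * QsOp n M))⁻¹
        * (LapS (fine n M) (n : ℂ) + (b : ℂ) • (QsAdj n M * QsOp n M))⁻¹ * QsAdj n M)⁻¹
      = ((kerRe n b M).map Complex.ofRealHom).submatrix (torFin M) (torFin M) := by
  have hM1 : ∀ i, 1 ≤ M i := fun i => Nat.one_le_iff_ne_zero.mpr (NeZero.ne (M i))
  refine Matrix.inv_eq_left_inv ?_
  rw [QGGQ_eq_submatrix_qggqRe n hn M hb, Matrix.submatrix_mul_equiv, ← Matrix.map_mul, kerRe_mul_qggqRe n hn b hb hM1,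
    Matrix.map_one Complex.ofRealHom (map_zero _) (map_one _), Matrix.submatrix_one_equiv]

/-! ## §3 The row-sum letter `cC`, uniformly in `n` and in the torus -/

include hn hb in
/-- [our bookkeeping] **THE ENTRIES OF `(Q′G′²Q′*)⁻¹` ARE pv17's KERNEL**: `‖(Q′G′²Q′*)⁻¹(y, y′)‖ = ‖torusKernel145M n b M (rep y − rep y′)‖`. -/
theorem norm_QGGQ_inv_apply (y y' : Tor M) :
    ‖(QsOp n M * (LapS (fine n M) (n : ℂ) + (b : ℂ) • (QsAdj n M * QsOp n M))⁻¹
        * (LapS (fine n M) (n : ℂ) + (b : ℂ) • (QsAdj n M * QsOp n M))⁻¹ * QsAdj n M)⁻¹ y y'‖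
      = ‖torusKernel145M n b M (rep M y - rep M y')‖ := by
  have hM1 : ∀ i, 1 ≤ M i := fun i => Nat.one_le_iff_ne_zero.mpr (NeZero.ne (M i))
  rw [QGGQ_inv_eq_submatrix_kerRe n hn M hb, Matrix.submatrix_apply, Matrix.map_apply, Complex.ofRealHom_eq_coe, kerRe_coe n hn b hb hM1,
    toZ_torFin, toZ_torFin]

/-- [our bookkeeping] **`cC` — THE COARSE SANDWICH LETTER IS IN THE TREE**: for `0 < b₋ ≤ b₊` there are `κ, c > 0` (functions of `d, b₋, b₊` only) such
that for every `n ≥ 1`, every torus `M`, every `b ∈ [b₋, b₊]` and every row `y`,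
`Σ_{y′} ‖(Q′·G′·G′·Q′*)⁻¹(y, y′)‖ ≤ c⁻¹·periodConst κ d·latticeConst(d+1, κ∕(d+1))`, `G′ = (Δ + bQ′*Q′)⁻¹`
(pv17's `inverse145_torusKernelM_decay_torusMetric` summed with `sum_exp_torusSupNorm_sub_rep_le`). -/
theorem exists_rowSum_QGGQ_inv_le (bminus bplus : ℝ) (hbm : 0 < bminus) :
    ∃ κ c : ℝ, 0 < κ ∧ 0 < c ∧
      ∀ (n : ℕ) [NeZero n] (_hn : 1 ≤ n) (M : Fin (d + 1) → ℕ) [∀ μ, NeZero (M μ)] (b : ℝ), bminus ≤ b → b ≤ bplus →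
        ∀ y : Tor M, ∑ y', ‖(QsOp n M * (LapS (fine n M) (n : ℂ) + (b : ℂ) • (QsAdj n M * QsOp n M))⁻¹
            * (LapS (fine n M) (n : ℂ) + (b : ℂ) • (QsAdj n M * QsOp n M))⁻¹ * QsAdj n M)⁻¹ y y'‖
          ≤ c⁻¹ * periodConst κ d * latticeConst (d + 1) (κ / (d + 1)) := by
  obtain ⟨κ, c, hκ, hc, h⟩ := inverse145_torusKernelM_decay_torusMetric d bminus bplus hbm
  refine ⟨κ, c, hκ, hc, fun n _ hn M _ b hb1 hb2 y => ?_⟩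
  have hb : 0 < b := lt_of_lt_of_le hbm hb1
  have hM1 : ∀ i, 1 ≤ M i := fun i => Nat.one_le_iff_ne_zero.mpr (NeZero.ne (M i))
  have hκ' : 0 < κ / (d + 1) := div_pos hκ (by positivity)
  have hpc : 0 ≤ c⁻¹ * periodConst κ d :=
    mul_nonneg (inv_nonneg.mpr hc.le) (B5Kernel166Decay.periodConst_pos hκ d).le
  calc ∑ y', ‖(QsOp n M * (LapS (fine n M) (n : ℂ) + (b : ℂ) • (QsAdj n M * QsOp n M))⁻¹
            * (LapS (fine n M) (n : ℂ) + (b : ℂ) • (QsAdj n M * QsOp n M))⁻¹ * QsAdj n M)⁻¹ y y'‖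
      = ∑ y', ‖torusKernel145M n b M (rep M y - rep M y')‖ := Finset.sum_congr rfl fun y' _ => norm_QGGQ_inv_apply n hn M hb y y'
    _ ≤ ∑ y' : Tor M, c⁻¹ * periodConst κ d * Real.exp (-(κ / (d + 1) * torusSupNorm M (rep M y - rep M y'))) :=
        Finset.sum_le_sum fun y' _ => h n b hb1 hb2 M hM1 _
    _ = c⁻¹ * periodConst κ d * ∑ y' : Tor M, Real.exp (-(κ / (d + 1) * torusSupNorm M (rep M y - rep M y'))) := by
        rw [Finset.mul_sum]
    _ ≤ c⁻¹ * periodConst κ d * latticeConst (d + 1) (κ / (d + 1)) :=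
        mul_le_mul_of_nonneg_left (sum_exp_torusSupNorm_sub_rep_le M hκ' (rep M y)) hpc

end Summit.QuantumFields.BalabanUV.Beta.FP.CoarseSandwichInverseRowSum

end
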